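import Summits.AtomisticToContinuum.HydrodynamicLimit.Theorems.JParityClosureLocalSecondLawLedgerKernel
import Summits.AtomisticToContinuum.HydrodynamicLimit.Theorems.LocalSecondLaw.Negative.EquilibriumL1
import Literature.MathematicalPhysics.KineticTheory.HardSphereUniformGas

/-!
# Cold balls: constants and the frozen-position statistic (definitions)

Lead c2's stub `eq_coldBalls` (equilibrium side-composition of line `exact-entropy-ledger-three-passivities`, crux
`JParityClosure.LocalSecondLaw`, stmt-AtomisticToContinuum-13081).  This small definitions file isolates the explicit
constants of the cold-ball estimate and the cold-ball statistic of a zipped configuration `zipConfig (xs, vs)` at frozen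
positions, so that the proof files (`…ColdBallsVelocity`, `…ColdBallsFrozen`, `…ColdBallsAssembly`) stay pure proofs:
* `coldC0 Θ = 1 + 2 log²(Θ/2)`;
* `coldD Θ = (2πΘ)^{-3/2}(4π/3)` (Gaussian small-ball constant);
* `coldSI Θ N = 3c₀² + 48 (log⁺(3Θ(N+1)²))⁴ + 768·64·D` (spread-case fourth-moment bound);
* `coldII Θ r N β = (2B/(N+1))(c₀ + 4 log⁺(6ΘB/β)² + 16(1+64D))`, `B = 3/(πr³)` (dominated-case bound as a function of the
  second-largest cone weight `β`), antitone in `β` (`coldII_antitone`, registered);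
* `coldStat Θ r xs x₀ vs = ρ_r (1 + log²θ_r) clamp(2 - 4θ_r/Θ, 0, 1)` of `zipConfig (xs, vs)` at `x₀`.
-/

noncomputable section

namespace Summit.AtomisticToContinuum.HydrodynamicLimit.Theorems.LocalSecondLawEquilibrium

open scoped BigOperators
open Literature.MathematicalPhysics.KineticTheory
open Literature.Analysis.FluidPDE
open Summit.AtomisticToContinuum.HydrodynamicLimit.Theorems.LocalSecondLawNegative
open Summit.AtomisticToContinuum.HydrodynamicLimit.Theorems.LocalSecondLawLedger
open Summit.AtomisticToContinuum.HydrodynamicLimit.Theorems.LocalSecondLawLedger.L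

variable {N : ℕ}

/-- `c₀(Θ) = 1 + 2 log²(Θ/2)`. -/
def coldC0 (Θ : ℝ) : ℝ := 1 + 2 * Real.log (Θ / 2) ^ 2

/-- The small-ball constant `D(Θ) = (2πΘ)^{-3/2}(4π/3)`. -/
def coldD (Θ : ℝ) : ℝ := (2 * Real.pi * Θ) ^ (-(3 : ℝ) / 2) * (4 / 3 * Real.pi)

/-- The spread-case moment bound `S_I(Θ, N) = 3c₀² + 48 (log⁺(3Θ(N+1)²))⁴ + 768·64·D`. -/
def coldSI (Θ : ℝ) (N : ℕ) : ℝ :=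
  3 * coldC0 Θ ^ 2 + 48 * (max 0 (Real.log (3 * Θ * ((N + 1 : ℕ) : ℝ) ^ 2))) ^ 4 + 768 * (64 * coldD Θ)

/-- The dominated-case bound as a function of the second-largest weight `β`:
`(2B/(N+1))·(c₀ + 4 log⁺(6ΘB/β)² + 16(1 + 64D))`. -/
def coldII (Θ r : ℝ) (N : ℕ) (β : ℝ) : ℝ :=
  2 * (3 / (Real.pi * r ^ 3)) / ((N + 1 : ℕ) : ℝ) *
    (coldC0 Θ + 4 * (max 0 (Real.log (6 * Θ * (3 / (Real.pi * r ^ 3)) / β))) ^ 2 + 16 * (1 + 64 * coldD Θ))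

/-- The cold-ball statistic of the zipped configuration at frozen positions (the unfolded form of `coldTerm`). -/
def coldStat (Θ r : ℝ) (xs : Fin (N + 1) → T3) (x₀ : T3) (vs : Fin (N + 1) → V3) : ℝ :=
  rhoC r (zipConfig (xs, vs)) x₀ * (1 + Real.log (thetaC r (zipConfig (xs, vs)) x₀) ^ 2) *
    max 0 (min 1 (2 - 4 * thetaC r (zipConfig (xs, vs)) x₀ / Θ))

/-- `c₀ > 0`. -/
theorem coldC0_pos (Θ : ℝ) : 0 < coldC0 Θ := by unfold coldC0; positivity

/-- `D ≥ 0`. -/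
theorem coldD_nonneg {Θ : ℝ} (hΘ : 0 ≤ Θ) : 0 ≤ coldD Θ := by unfold coldD; positivity

/-- `S_I ≥ 0`. -/
theorem coldSI_nonneg {Θ : ℝ} (hΘ : 0 ≤ Θ) (N : ℕ) : 0 ≤ coldSI Θ N := by
  unfold coldSI; have := coldD_nonneg hΘ; positivity

/-- `coldII ≥ 0`. -/
theorem coldII_nonneg {Θ r : ℝ} (hΘ : 0 ≤ Θ) (hr : 0 < r) (N : ℕ) (β : ℝ) : 0 ≤ coldII Θ r N β := by
  unfold coldII; have := coldD_nonneg hΘ; have := coldC0_pos Θ; positivity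

/-- `coldStat ≥ 0` (for `r > 0`). -/
theorem coldStat_nonneg {Θ r : ℝ} (hr : 0 < r) (xs : Fin (N + 1) → T3) (x₀ : T3) (vs : Fin (N + 1) → V3) :
    0 ≤ coldStat Θ r xs x₀ vs := by
  unfold coldStat
  have := rhoC_nonneg hr (zipConfig (xs, vs)) x₀
  positivity

/-- **`coldII` is antitone in the second-largest weight** (registered sub-goal of `eq_coldBalls`): a smaller `β' ≤ β`
only enlarges `log⁺(6ΘB/β)`. -/
theorem coldII_antitone : ∀ {Θ r : ℝ}, 0 < Θ → 0 < r → ∀ (N : ℕ) {β β' : ℝ}, 0 < β' → β' ≤ β →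
    coldII Θ r N β ≤ coldII Θ r N β' := by
  intro Θ r hΘ hr N β β' hβ' h
  have hB : 0 < 3 / (Real.pi * r ^ 3) := by positivity
  have hβ : 0 < β := hβ'.trans_le h
  have hlog : max 0 (Real.log (6 * Θ * (3 / (Real.pi * r ^ 3)) / β)) ≤
      max 0 (Real.log (6 * Θ * (3 / (Real.pi * r ^ 3)) / β')) :=
    max_le_max le_rfl (Real.log_le_log (by positivity) (div_le_div_of_nonneg_left (by positivity) hβ' h))
  have h0 : 0 ≤ max 0 (Real.log (6 * Θ * (3 / (Real.pi * r ^ 3)) / β)) := le_max_left _ _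
  have hsq := pow_le_pow_left₀ h0 hlog 2
  have hD := coldD_nonneg hΘ.le
  unfold coldII
  exact mul_le_mul_of_nonneg_left (by linarith) (by positivity)

end Summit.AtomisticToContinuum.HydrodynamicLimit.Theorems.LocalSecondLawEquilibrium

end
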